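import Summits.QuantumFields.QCD.Theorems.NestedDissectionSeaLightQuarkCompletionLightBodyAbove
import Summits.QuantumFields.QCD.Theorems.NestedDissectionSeaLightQuarkCompletionGlue
import Summits.QuantumFields.QCD.Theorems.LightQuarkCompletion.Negative.Anatomy
import Summits.QuantumFields.QCD.Theses.EulerDescent
import Summits.QuantumFields.QCD.Theses.QuarksAsStableAction

/-!
# Crux `LightQuarkCompletion` (stmt-QuantumFields-18066) — line `Sketch`, stub `stub_lightBodySubseq` (B2c′):
# by-name reductions onto `QuarksAsStableAction.MassContinuation` and `EulerDescent.RetypedContinuumComplement`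

Worker file for the registered stub `LightQuarkJumpLine.stub_lightBodySubseq` ("light body along a subsequence",
signature in `stub_lightBodySubseq.sig.txt`; lead prover-line-stmt-QuantumFields-18066-c2-0, 2026-08-17).

**Verdict: `stub-blocked`, with two by-name reductions landed.**  The stub asks, for a threshold regularisation `reg`
(two-sided parity pin and `QCDOf` body above `M₀ ≥ 0`) re-centred at a germ `J` (`m_crit ↦ m_crit + a J / Z_m`, the
explicit `QCDRegularisation.mk`) carrying the zero-threshold pin, for the `QCDOf` body at EVERY positive tuple of the
re-centred regularisation along SOME subsequence `ψ`.  By `recentre_scheme` this is the body of `reg` at every tuple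
strictly above the germ, `J < m_f` (§1, `subseqBody_of_bodyAboveGerm`, `ψ = id`): above `M₀` it is the hypothesis,
between `J` and `M₀` it is the light-quark continuation of the body for the SAME cutoff data — constructive QFT supplied
by no hypothesis and by no landed fact.  Two open route items state exactly such a same-regularisation continuation, each
from a LATTICE-GAP input; this file proves the stub from either item BY NAME plus the matching light-gap fact (stated as a
closed hypothesis over the stub's own hypotheses, no definition introduced):

* §2 `body_aboveGerm_of_massContinuation`, §4 `stub_lightBodySubseq_of_massContinuation`:
  `QuarksAsStableAction.MassContinuation` (item stmt-QuantumFields-18327, "the massive phase is open below a uniformly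
  gapped threshold": descent by some `δ > 0` below a threshold carrying one lattice-gap rate) + ONE RATE ON EVERY HALF-ORTHANT ABOVE THE GERM
  (`∀ M > J, ∃ ε > 0, ∀ m > M, (reg.scheme m 0 0).HasLatticeMassGap ε`) ⟹ the stub.  Mechanism: the set of admissible
  thresholds `{M | body above M}` is an upper set containing `M₀`; were some `M₁ > J` not admissible, its infimum `M⋆ ≥ M₁`
  would itself be admissible (finite tuples leave room) and `MassContinuation` at `(M⋆, ε(M⋆))` would push below it.
  No branch hypothesis is needed (`MassContinuation` reads only `HasMassScaling`).
* §3 `body_aboveGerm_of_retypedContinuumComplement`, §4 `stub_lightBodySubseq_of_retypedContinuumComplement`: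
  `EulerDescent.RetypedContinuumComplement` (item stmt-QuantumFields-16903, "heavy body + lattice gap at every positive
  tuple ⟹ full body, same `reg`") + the WEAK BRANCH AT THE GERM (`∀ᶠ k, −1 ≤ m_crit k + a_k J / Z_m k`; for the lead it
  follows from B2b′, `m_crit → 0`) + the PER-TUPLE LATTICE GAP ABOVE THE GERM
  (`∀ m, (∀ f, J < m_f) → ∃ Δ > 0, (reg.scheme m 0 0).HasLatticeMassGap Δ`) ⟹ the stub.  Mechanism: for a tuple `m` above
  the germ pick `D ∈ (J, min_f m_f)` and apply the item to the RGI up-shift `upShift reg D`: its STRICT branch is the weak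
  branch at `J` plus `a_k (D − J)/Z_m k > 0`, its heavy body above `|M₀ − D| + 1` is the threshold body re-based
  (`body_upShift`), its light gap at every positive tuple is the per-tuple gap above the germ; read the output at `m − D > 0`.

Neither the strict/weak branch at the germ nor any lattice gap below `M₀` is derivable from the stub's hypotheses (the
pins are phase-quenched sign probabilities of `Re det D_W`, Seiler positivity only bounds pin masses into `(−8, 0)`;
`Cruxes/LightQuarkCompletion/Disproof.lean` §8).  `HeavyThresholdYMBridge.ChiralCompletion` (item stmt-QuantumFields-17661,
re-pin offset `δ` existential) would reduce the stub from the same uniform light gap by the same mechanism (`δ ≤ J` is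
forced by one rate above `(J+δ)/2`); recorded, not formalised here (its decl was not yet in the farm build of its module
at the time of writing).  Pure logic over the tree's definitions; nothing in this file asserts a Theses decl.
-/

noncomputable section

namespace Summit.QuantumFields.QCD.Theorems.LightQuarkJumpLine

open MeasureTheory Filter Topology
open Literature.MathematicalPhysics.QuantumFieldTheory Literature.MathematicalPhysics.QuantumLattice
  Literature.Probability.LatticeModels
open Summit.QuantumFields.QCD.Theorems.CoerciveSeaNegative (PinClause tendsto_a_div_Zm massExponent_pos)
open Summit.QuantumFields.QCD.Theorems.EarlyCrosserLawNegative (UpperPin)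
open Summit.QuantumFields.QCD.Theorems.LightQuarkCompletion.Negative (Body upShift upShift_scheme upShift_mcrit
  body_upShift body_mono hasMassScaling_upShift hasAsymptoticScaling_upShift)

/-! ## §1 From the body above the germ to the stub's conclusion -/

section Germ

variable {Nf : ℕ} (reg : QCDRegularisation Nf) (J : ℝ)

/-- Finitely many components strictly above `J` leave room: some `M > J` is still below all of them
(`N_f ≠ 0` to name a least component). [folklore] -/
theorem exists_lt_forall_lt [Nonempty (Fin Nf)] {J : ℝ} {m : Fin Nf → ℝ} (hm : ∀ f, J < m f) :
    ∃ M : ℝ, J < M ∧ ∀ f, M < m f := by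
  obtain ⟨f₀, -, hf₀⟩ := Finset.exists_min_image Finset.univ m Finset.univ_nonempty
  refine ⟨(J + m f₀) / 2, by linarith [hm f₀], fun f => ?_⟩
  have h1 := hf₀ f (Finset.mem_univ f)
  have h2 := hm f₀
  linarith

/-- The body above every threshold `M > J` is the body above `J` (each tuple above `J` is above some `M > J`).
[folklore] -/
theorem body_of_forall_gt [Nonempty (Fin Nf)] {J : ℝ} (h : ∀ M : ℝ, J < M → Body Nf reg M) : Body Nf reg J := by
  intro m hm
  obtain ⟨M, hJM, hMm⟩ := exists_lt_forall_lt hm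
  exact h M hJM m hMm

/-- **The stub's conclusion from the body of `reg` above the germ** (`ψ = id`): if `reg` carries the `QCDOf` body at
every tuple strictly above `J`, then the re-centring of `reg` at `J`, reindexed along the identity, carries it at every
positive tuple — `recentre_scheme` (`body_recentre_iff`) and heredity along subsequences (`body_restrict`). [folklore] -/
theorem subseqBody_of_bodyAboveGerm (h : Body Nf reg J) :
    ∃ (ψ : ℕ → ℕ) (hψ : StrictMono ψ), ∀ m : Fin Nf → ℝ, (∀ f, 0 < m f) →
          ∃ (z shift : QCDField Nf → ℕ → ℝ) (T : OSData (QCDField Nf) 4),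
          IsQCDAlong (((QCDRegularisation.mk reg.a reg.a_pos reg.tendsto_a reg.β reg.L reg.tendsto_L
            (fun k => reg.mcrit k + reg.a k * J / reg.Zm k) reg.Zm reg.Zm_pos : QCDRegularisation Nf).restrict ψ
              hψ.tendsto_atTop).scheme m z shift) T ∧ T.IsNontrivial QCDField.glue ∧ T.IsNonGaussian QCDField.glue ∧
            (∀ f g : Fin Nf, f ≠ g → T.IsNontrivial (QCDField.pseudoRe f g)) ∧
              ∃ Δ > 0, T.HasMassGap Δ ∧
                (((QCDRegularisation.mk reg.a reg.a_pos reg.tendsto_a reg.β reg.L reg.tendsto_L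
            (fun k => reg.mcrit k + reg.a k * J / reg.Zm k) reg.Zm reg.Zm_pos : QCDRegularisation Nf).restrict ψ
              hψ.tendsto_atTop).scheme m z shift).HasLatticeMassGap Δ := by
  refine ⟨id, strictMono_id, body_restrict _ id strictMono_id (M₀ := 0) ?_⟩
  exact (body_recentre_iff reg J).2 fun m hm => h (fun f => J + m f) fun f => by linarith [hm f]

end Germ

/-! ## §2 The body above the germ from `MassContinuation` and one lattice-gap rate on every half-orthant above it -/

/-- **Same-regularisation descent to the germ.**  `QuarksAsStableAction.MassContinuation` (BY NAME), mass scaling, the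
body above `M₀`, and one lattice-gap rate `ε(M) > 0` on every half-orthant `{m | ∀ f, M < m_f}`, `M > J`, give the body
of `reg` at every tuple above the germ `J`.  The admissible thresholds `S = {M | body above M}` form an upper set
(`body_mono`) containing `M₀`; if some `M₁ > J` were not admissible, `M₁` would bound `S` from below, `M⋆ := inf S ≥ M₁`
would be admissible (`exists_lt_of_csInf_lt` + `exists_lt_forall_lt`), and `MassContinuation` at `(M⋆, ε(M⋆))` would
make `M⋆ − δ` admissible — below the infimum. [folklore] -/
theorem body_aboveGerm_of_massContinuation {Nf : ℕ} (reg : QCDRegularisation Nf) (J : ℝ)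
    (hMC : Summit.QuantumFields.QCD.Theses.QuarksAsStableAction.MassContinuation) (hNf : Nf = 2 ∨ Nf = 3)
    (hMS : reg.HasMassScaling) {M₀ : ℝ} (hbody : Body Nf reg M₀)
    (hgap : ∀ M : ℝ, J < M → ∃ ε > 0, ∀ m : Fin Nf → ℝ, (∀ f, M < m f) → (reg.scheme m 0 0).HasLatticeMassGap ε) :
    Body Nf reg J := by
  haveI : NeZero Nf := ⟨by rcases hNf with rfl | rfl <;> norm_num⟩
  haveI : Nonempty (Fin Nf) := ⟨0⟩
  refine body_of_forall_gt reg fun M₁ hJM₁ => ?_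
  by_contra hM₁
  set S : Set ℝ := {M | Body Nf reg M} with hS
  have hne : S.Nonempty := ⟨M₀, hbody⟩
  have hlb : M₁ ∈ lowerBounds S := by
    intro M hM
    by_contra hlt
    push Not at hlt
    exact hM₁ (body_mono hM hlt.le)
  have hbdd : BddBelow S := ⟨M₁, hlb⟩
  have hle : M₁ ≤ sInf S := le_csInf hne hlb
  -- every threshold strictly above the infimum is admissible, hence so is the infimum
  have habove : ∀ M : ℝ, sInf S < M → Body Nf reg M := by
    intro M hM
    obtain ⟨s, hs, hsM⟩ := exists_lt_of_csInf_lt hne hM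
    exact body_mono hs hsM.le
  have hinf : Body Nf reg (sInf S) := body_of_forall_gt reg habove
  -- descend below the infimum
  obtain ⟨ε, hε, hgapε⟩ := hgap (sInf S) (lt_of_lt_of_le hJM₁ hle)
  obtain ⟨δ, hδ, hbody'⟩ := hMC Nf hNf reg (sInf S) ε hMS hε hinf hgapε
  have hmem : sInf S - δ ∈ S := by
    show Body Nf reg (sInf S - δ)
    exact hbody'
  have := csInf_le hbdd hmem
  linarith

/-! ## §3 The body above the germ from `RetypedContinuumComplement`, the weak branch at the germ and per-tuple gaps -/

/-- **The weak branch at any germ from the physical branch** (how the lead discharges the branch fact of §4 from B2b′,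
`m_crit → 0`): `m_crit k + a_k J / Z_m k → 0` (`tendsto_mcrit_recentre`, `N_f ≤ 16`), so it is eventually `≥ −1`
(indeed `> −1`). [folklore] -/
theorem branchAtGerm_of_tendsto_mcrit {Nf : ℕ} (reg : QCDRegularisation Nf) (J : ℝ) (hNf : Nf ≤ 16)
    (hMS : reg.HasMassScaling) (h : Tendsto reg.mcrit atTop (𝓝 0)) :
    ∀ᶠ k : ℕ in atTop, -1 ≤ reg.mcrit k + reg.a k * J / reg.Zm k :=
  (tendsto_mcrit_recentre reg J hNf hMS h).eventually_const_le (by norm_num)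

/-- **Same-regularisation completion down to the germ.**  `EulerDescent.RetypedContinuumComplement` (BY NAME), both
scalings, the body above `M₀`, the WEAK branch at the germ (`∀ᶠ k, −1 ≤ m_crit k + a_k J / Z_m k`) and a lattice gap
`Δ(m) > 0` at every tuple above the germ give the body of `reg` at every tuple above the germ.  For a tuple `m` with
`J < m_f` pick `D ∈ (J, min_f m_f)` (`exists_lt_forall_lt`) and apply the item to the RGI up-shift `upShift reg D`
(`m_crit ↦ m_crit + a D / Z_m`): STRICT branch from the weak branch at `J` plus `a_k (D − J) / Z_m k > 0`; heavy body
above `|M₀ − D| + 1 > 0` from the threshold body (`body_upShift`); light gap at every positive tuple `m'` from the gap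
at `D + m'` (`upShift_scheme`).  Its output at the positive tuple `m − D` is the body of `reg` at `m`. [folklore] -/
theorem body_aboveGerm_of_retypedContinuumComplement {Nf : ℕ} (reg : QCDRegularisation Nf) (J : ℝ)
    (hRCC : Summit.QuantumFields.QCD.Theses.EulerDescent.RetypedContinuumComplement) (hNf : Nf = 2 ∨ Nf = 3)
    (hMS : reg.HasMassScaling) (hAS : (reg.scheme 0 0 0).HasAsymptoticScaling) {M₀ : ℝ} (hbody : Body Nf reg M₀)
    (hbr : ∀ᶠ k : ℕ in atTop, -1 ≤ reg.mcrit k + reg.a k * J / reg.Zm k)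
    (hgap : ∀ m : Fin Nf → ℝ, (∀ f, J < m f) → ∃ Δ > 0, (reg.scheme m 0 0).HasLatticeMassGap Δ) :
    Body Nf reg J := by
  haveI : NeZero Nf := ⟨by rcases hNf with rfl | rfl <;> norm_num⟩
  haveI : Nonempty (Fin Nf) := ⟨0⟩
  intro m hm
  obtain ⟨D, hJD, hDm⟩ := exists_lt_forall_lt hm
  -- the up-shift by `D`: strict branch
  have hbrD : ∀ᶠ k : ℕ in atTop, (-1 : ℝ) < (upShift reg D).mcrit k := by
    filter_upwards [hbr] with k hk
    rw [upShift_mcrit]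
    have hpos : 0 < reg.a k * (D - J) / reg.Zm k :=
      div_pos (mul_pos (reg.a_pos k) (by linarith)) (reg.Zm_pos k)
    have hsplit : reg.mcrit k + reg.a k * D / reg.Zm k =
        (reg.mcrit k + reg.a k * J / reg.Zm k) + reg.a k * (D - J) / reg.Zm k := by ring
    linarith
  -- light gap of the up-shift at every positive tuple
  have hlight : ∀ m' : Fin Nf → ℝ, (∀ f, 0 < m' f) → ∃ Δ > 0, ((upShift reg D).scheme m' 0 0).HasLatticeMassGap Δ := by
    intro m' hm'
    rw [upShift_scheme]
    exact hgap _ fun f => by linarith [hm' f]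
  -- the item applied to the up-shift (heavy body above `|M₀ - D| + 1` from the threshold body)
  have hB : Body Nf (upShift reg D) 0 := by
    refine hRCC Nf hNf (upShift reg D) ((hasMassScaling_upShift reg D).mpr hMS)
      ((hasAsymptoticScaling_upShift reg D).mpr hAS) hbrD ⟨|M₀ - D| + 1, by positivity, fun m' hm' => ?_⟩ hlight
    exact body_upShift (M₁ := M₀ - D) (by linarith) hbody m' fun f => by
      have h1 := hm' f
      have h2 := le_abs_self (M₀ - D)
      linarith
  -- read off at the positive tuple `m - D`
  obtain ⟨z, shift, T, hQ, hN, hG, hP, Δ, hΔ, hT, hL⟩ := hB (fun f => m f - D) fun f => by linarith [hDm f]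
  have hm_eq : (fun f => D + (m f - D)) = m := funext fun f => by ring
  rw [upShift_scheme, hm_eq] at hQ hL
  exact ⟨z, shift, T, hQ, hN, hG, hP, Δ, hΔ, hT, hL⟩

/-! ## §4 The registered reductions (the stub's signature VERBATIM after the named facts) -/

/-- **Stub B2c′ from `MassContinuation` — registered helper `stub_lightBodySubseq_of_massContinuation`.**
`QuarksAsStableAction.MassContinuation` (BY NAME) and the light-gap fact "under the stub's hypotheses, one lattice-gap
rate on every half-orthant strictly above the germ: `∀ M > J, ∃ ε > 0, ∀ m > M, (reg.scheme m 0 0).HasLatticeMassGap ε`"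
imply the registered signature of `stub_lightBodySubseq` verbatim (`ψ = id`; §2 + §1). [folklore] -/
theorem stub_lightBodySubseq_of_massContinuation :
    Summit.QuantumFields.QCD.Theses.QuarksAsStableAction.MassContinuation →
    (∀ Nf : ℕ, (Nf = 2 ∨ Nf = 3) → ∀ reg : QCDRegularisation Nf, reg.HasMassScaling →
    (reg.scheme 0 0 0).HasAsymptoticScaling → (∀ᶠ k : ℕ in atTop, -1 ≤ reg.mcrit k) → ∀ M₀ : ℝ, 0 ≤ M₀ →
    (∀ m : Fin Nf → ℝ, (∀ f, M₀ < m f) → ∃ R : ℝ, 0 < R ∧ PinClause Nf reg M₀ m R ∧ UpperPin Nf reg M₀ m R) →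
    (∀ m : Fin Nf → ℝ, (∀ f, M₀ < m f) → ∃ (z shift : QCDField Nf → ℕ → ℝ) (T : OSData (QCDField Nf) 4),
      IsQCDAlong (reg.scheme m z shift) T ∧ T.IsNontrivial QCDField.glue ∧ T.IsNonGaussian QCDField.glue ∧
        (∀ f g : Fin Nf, f ≠ g → T.IsNontrivial (QCDField.pseudoRe f g)) ∧
          ∃ Δ > 0, T.HasMassGap Δ ∧ (reg.scheme m z shift).HasLatticeMassGap Δ) →
    ∀ J : ℝ, (∀ m : Fin Nf → ℝ, (∀ f, 0 < m f) → ∃ R : ℝ, 0 < R ∧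
      PinClause Nf (QCDRegularisation.mk reg.a reg.a_pos reg.tendsto_a reg.β reg.L reg.tendsto_L
        (fun k => reg.mcrit k + reg.a k * J / reg.Zm k) reg.Zm reg.Zm_pos) 0 m R ∧
      UpperPin Nf (QCDRegularisation.mk reg.a reg.a_pos reg.tendsto_a reg.β reg.L reg.tendsto_L
        (fun k => reg.mcrit k + reg.a k * J / reg.Zm k) reg.Zm reg.Zm_pos) 0 m R) →
      ∀ M : ℝ, J < M → ∃ ε > 0, ∀ m : Fin Nf → ℝ, (∀ f, M < m f) → (reg.scheme m 0 0).HasLatticeMassGap ε) →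
   ∀ Nf : ℕ, (Nf = 2 ∨ Nf = 3) → ∀ reg : QCDRegularisation Nf, reg.HasMassScaling →
    (reg.scheme 0 0 0).HasAsymptoticScaling → (∀ᶠ k : ℕ in atTop, -1 ≤ reg.mcrit k) → ∀ M₀ : ℝ, 0 ≤ M₀ →
    (∀ m : Fin Nf → ℝ, (∀ f, M₀ < m f) → ∃ R : ℝ, 0 < R ∧ PinClause Nf reg M₀ m R ∧ UpperPin Nf reg M₀ m R) →
    (∀ m : Fin Nf → ℝ, (∀ f, M₀ < m f) → ∃ (z shift : QCDField Nf → ℕ → ℝ) (T : OSData (QCDField Nf) 4),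
      IsQCDAlong (reg.scheme m z shift) T ∧ T.IsNontrivial QCDField.glue ∧ T.IsNonGaussian QCDField.glue ∧
        (∀ f g : Fin Nf, f ≠ g → T.IsNontrivial (QCDField.pseudoRe f g)) ∧
          ∃ Δ > 0, T.HasMassGap Δ ∧ (reg.scheme m z shift).HasLatticeMassGap Δ) →
    ∀ J : ℝ, (∀ m : Fin Nf → ℝ, (∀ f, 0 < m f) → ∃ R : ℝ, 0 < R ∧
      PinClause Nf (QCDRegularisation.mk reg.a reg.a_pos reg.tendsto_a reg.β reg.L reg.tendsto_L
        (fun k => reg.mcrit k + reg.a k * J / reg.Zm k) reg.Zm reg.Zm_pos) 0 m R ∧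
      UpperPin Nf (QCDRegularisation.mk reg.a reg.a_pos reg.tendsto_a reg.β reg.L reg.tendsto_L
        (fun k => reg.mcrit k + reg.a k * J / reg.Zm k) reg.Zm reg.Zm_pos) 0 m R) →
    ∃ (ψ : ℕ → ℕ) (hψ : StrictMono ψ), ∀ m : Fin Nf → ℝ, (∀ f, 0 < m f) →
      ∃ (z shift : QCDField Nf → ℕ → ℝ) (T : OSData (QCDField Nf) 4),
      IsQCDAlong (((QCDRegularisation.mk reg.a reg.a_pos reg.tendsto_a reg.β reg.L reg.tendsto_L
        (fun k => reg.mcrit k + reg.a k * J / reg.Zm k) reg.Zm reg.Zm_pos : QCDRegularisation Nf).restrict ψ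
          hψ.tendsto_atTop).scheme m z shift) T ∧ T.IsNontrivial QCDField.glue ∧ T.IsNonGaussian QCDField.glue ∧
        (∀ f g : Fin Nf, f ≠ g → T.IsNontrivial (QCDField.pseudoRe f g)) ∧
          ∃ Δ > 0, T.HasMassGap Δ ∧
            (((QCDRegularisation.mk reg.a reg.a_pos reg.tendsto_a reg.β reg.L reg.tendsto_L
        (fun k => reg.mcrit k + reg.a k * J / reg.Zm k) reg.Zm reg.Zm_pos : QCDRegularisation Nf).restrict ψ
          hψ.tendsto_atTop).scheme m z shift).HasLatticeMassGap Δ := by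
  intro hMC hGap Nf hNf reg hMS hAS hbr M₀ hM₀ hpin hbody J hpin'
  exact subseqBody_of_bodyAboveGerm reg J (body_aboveGerm_of_massContinuation reg J hMC hNf hMS hbody
    (hGap Nf hNf reg hMS hAS hbr M₀ hM₀ hpin hbody J hpin'))

/-- **Stub B2c′ from `RetypedContinuumComplement` — registered helper
`stub_lightBodySubseq_of_retypedContinuumComplement`.**  `EulerDescent.RetypedContinuumComplement` (BY NAME), the
branch fact "under the stub's hypotheses, the weak branch at the germ: `∀ᶠ k, −1 ≤ m_crit k + a_k J / Z_m k`" (for the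
lead: a corollary of B2b′, `m_crit → 0`, via `tendsto_mcrit_recentre`) and the light-gap fact "under the stub's
hypotheses, a lattice gap at every tuple strictly above the germ: `∀ m, (∀ f, J < m_f) → ∃ Δ > 0,
(reg.scheme m 0 0).HasLatticeMassGap Δ`" imply the registered signature of `stub_lightBodySubseq` verbatim
(`ψ = id`; §3 + §1).  The two facts are written over the standing disprover's VERBATIM clause abbreviations
`LightQuarkCompletion.Negative.PinPkg` (two-sided pin above a threshold), `.Body` (the `QCDOf` body above a threshold) and
`.upShift reg J` (the re-centring, definitionally the explicit `QCDRegularisation.mk` of the stub), fully qualified, only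
to keep the registered one-line signature under the gate's 4000-character cap; they unfold definitionally to the stub's
hypothesis texts (the proof feeds the stub's hypotheses to them unchanged). [folklore] -/
theorem stub_lightBodySubseq_of_retypedContinuumComplement :
    Summit.QuantumFields.QCD.Theses.EulerDescent.RetypedContinuumComplement →
    (∀ Nf : ℕ, (Nf = 2 ∨ Nf = 3) → ∀ reg : QCDRegularisation Nf, reg.HasMassScaling →
      (reg.scheme 0 0 0).HasAsymptoticScaling → (∀ᶠ k : ℕ in atTop, -1 ≤ reg.mcrit k) → ∀ M₀ : ℝ, 0 ≤ M₀ →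
      Summit.QuantumFields.QCD.Theorems.LightQuarkCompletion.Negative.PinPkg Nf reg M₀ →
      Summit.QuantumFields.QCD.Theorems.LightQuarkCompletion.Negative.Body Nf reg M₀ → ∀ J : ℝ,
      Summit.QuantumFields.QCD.Theorems.LightQuarkCompletion.Negative.PinPkg Nf
        (Summit.QuantumFields.QCD.Theorems.LightQuarkCompletion.Negative.upShift reg J) 0 →
      ∀ᶠ k : ℕ in atTop, -1 ≤ reg.mcrit k + reg.a k * J / reg.Zm k) →
    (∀ Nf : ℕ, (Nf = 2 ∨ Nf = 3) → ∀ reg : QCDRegularisation Nf, reg.HasMassScaling →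
      (reg.scheme 0 0 0).HasAsymptoticScaling → (∀ᶠ k : ℕ in atTop, -1 ≤ reg.mcrit k) → ∀ M₀ : ℝ, 0 ≤ M₀ →
      Summit.QuantumFields.QCD.Theorems.LightQuarkCompletion.Negative.PinPkg Nf reg M₀ →
      Summit.QuantumFields.QCD.Theorems.LightQuarkCompletion.Negative.Body Nf reg M₀ → ∀ J : ℝ,
      Summit.QuantumFields.QCD.Theorems.LightQuarkCompletion.Negative.PinPkg Nf
        (Summit.QuantumFields.QCD.Theorems.LightQuarkCompletion.Negative.upShift reg J) 0 →
      ∀ m : Fin Nf → ℝ, (∀ f, J < m f) → ∃ Δ > 0, (reg.scheme m 0 0).HasLatticeMassGap Δ) →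
   ∀ Nf : ℕ, (Nf = 2 ∨ Nf = 3) → ∀ reg : QCDRegularisation Nf, reg.HasMassScaling →
    (reg.scheme 0 0 0).HasAsymptoticScaling → (∀ᶠ k : ℕ in atTop, -1 ≤ reg.mcrit k) → ∀ M₀ : ℝ, 0 ≤ M₀ →
    (∀ m : Fin Nf → ℝ, (∀ f, M₀ < m f) → ∃ R : ℝ, 0 < R ∧ PinClause Nf reg M₀ m R ∧ UpperPin Nf reg M₀ m R) →
    (∀ m : Fin Nf → ℝ, (∀ f, M₀ < m f) → ∃ (z shift : QCDField Nf → ℕ → ℝ) (T : OSData (QCDField Nf) 4),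
      IsQCDAlong (reg.scheme m z shift) T ∧ T.IsNontrivial QCDField.glue ∧ T.IsNonGaussian QCDField.glue ∧
        (∀ f g : Fin Nf, f ≠ g → T.IsNontrivial (QCDField.pseudoRe f g)) ∧
          ∃ Δ > 0, T.HasMassGap Δ ∧ (reg.scheme m z shift).HasLatticeMassGap Δ) →
    ∀ J : ℝ, (∀ m : Fin Nf → ℝ, (∀ f, 0 < m f) → ∃ R : ℝ, 0 < R ∧
      PinClause Nf (QCDRegularisation.mk reg.a reg.a_pos reg.tendsto_a reg.β reg.L reg.tendsto_L
        (fun k => reg.mcrit k + reg.a k * J / reg.Zm k) reg.Zm reg.Zm_pos) 0 m R ∧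
      UpperPin Nf (QCDRegularisation.mk reg.a reg.a_pos reg.tendsto_a reg.β reg.L reg.tendsto_L
        (fun k => reg.mcrit k + reg.a k * J / reg.Zm k) reg.Zm reg.Zm_pos) 0 m R) →
    ∃ (ψ : ℕ → ℕ) (hψ : StrictMono ψ), ∀ m : Fin Nf → ℝ, (∀ f, 0 < m f) →
      ∃ (z shift : QCDField Nf → ℕ → ℝ) (T : OSData (QCDField Nf) 4),
      IsQCDAlong (((QCDRegularisation.mk reg.a reg.a_pos reg.tendsto_a reg.β reg.L reg.tendsto_L
        (fun k => reg.mcrit k + reg.a k * J / reg.Zm k) reg.Zm reg.Zm_pos : QCDRegularisation Nf).restrict ψ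
          hψ.tendsto_atTop).scheme m z shift) T ∧ T.IsNontrivial QCDField.glue ∧ T.IsNonGaussian QCDField.glue ∧
        (∀ f g : Fin Nf, f ≠ g → T.IsNontrivial (QCDField.pseudoRe f g)) ∧
          ∃ Δ > 0, T.HasMassGap Δ ∧
            (((QCDRegularisation.mk reg.a reg.a_pos reg.tendsto_a reg.β reg.L reg.tendsto_L
        (fun k => reg.mcrit k + reg.a k * J / reg.Zm k) reg.Zm reg.Zm_pos : QCDRegularisation Nf).restrict ψ
          hψ.tendsto_atTop).scheme m z shift).HasLatticeMassGap Δ := by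
  intro hRCC hBranch hGap Nf hNf reg hMS hAS hbr M₀ hM₀ hpin hbody J hpin'
  exact subseqBody_of_bodyAboveGerm reg J (body_aboveGerm_of_retypedContinuumComplement reg J hRCC hNf hMS hAS hbody
    (hBranch Nf hNf reg hMS hAS hbr M₀ hM₀ hpin hbody J hpin') (hGap Nf hNf reg hMS hAS hbr M₀ hM₀ hpin hbody J hpin'))

end Summit.QuantumFields.QCD.Theorems.LightQuarkJumpLine

end
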